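import Summits.BirchSwinnertonDyer.BirchSwinnertonDyer.Theorems.ByReductionTypeAtTwoFineSelmerConjAAtTwoAdditivePotGoodTwoLayerDoorEvenIndex
import Summits.BirchSwinnertonDyer.BirchSwinnertonDyer.Theorems.ByReductionTypeAtTwoFineSelmerConjAAtTwoAdditivePotGoodClassNumberOne780
import HarnessLib

/-!
# Route `ByReductionTypeAtTwo` (rung K4), crux C1″ `FineSelmerConjAAtTwoAdditivePotGood` (item stmt-BirchSwinnertonDyer-22615):
# TWO-LAYER STAMPS, EVEN-INDEX TYPE `2 = 𝔭²𝔮`, part C — census rows `227772e1` (`d = -11988`), `279440c1` (`d = 9980`), `297264q1` (`d = -6756`): Fukuda's index `0` by even-index certificates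
# (kernel), hence (A)₂ modulo `hLim2` and TWO displayed bits per row — the parities of `h(F)` and `h(F(√2))` (census: both odd)
# (a `--supports 22615` file; seat `bsd-2adic-k4-w1` GEN 5; sequel of `…TwoLayerStampsEvenIndexB`)

HONEST FRAMING (cell `bsd-2adic`, D-0036/D-0054/D-0152): per-class stamps; conditional on `hLim2` (Lim 2017 Thm. 3.5 at `2`) BY NAME and on TWO
displayed bits per row: `2 ∤ #Cl(𝓞 ℚ(θ))` (census column `cyc3`) and «`e_1 = 0` along the cyclotomic `ℤ₂`-extensions of `ℚ(θ)`» =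
`2 ∤ h(ℚ(θ, √2))` (`…TwoLayerDoor` §2; census column `cyc6`) — both from `addL2x/gen5/conjA2_census_j289938_classes.tsv`, PARI, NOT kernel
(the fields are too large for a short Minkowski certificate: `|d| ≥ 6756`). KERNEL: irreducibility, `ℚ(P) = ℚ(θ)` (explicit change of
generator to an odd-index model of the field), the even-index certificate (four vectors per field, the seat's `gen/cert_search.py`, verified
as ring identities + one companion determinant), Fukuda's index `0` (`totallyRamifiedFrom_zero_of_evenIndexCertificate`, p689647) and Fukuda's
Thm. 1 (1) (`_holds`). Closes nothing at the `∀`-level; nothing booked; BSD is not proved by any of this. THESE ROWS LEAVE `C1″-RES` FOR THE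
DOOR SIDE (the grade of GEN 4's one-bit door rows, with one bit more).

THE FIELDS (odd-index models, so that `ℤ[θ]` is `2`-maximal and the certificate lives in `ℤ[θ]`): `d = -11988`: `X³ + (0)X² + (33)X + (-76)`; `d = 9980`: `X³ + (-1)X² + (-36)X + (-70)`; `d = -6756`: `X³ + (0)X² + (-51)X + (-148)`.

References: [Fukuda1994] Thm. 1 (1); [Lim2017FineSelmer] Thm. 3.5, Lemma 3.2; [CoatesSujatha2005] (A); [Marcus1977] Ch. 2;
cell TSV `addL2x/gen5/conjA2_census_j289938_classes.tsv`.
-/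

set_option autoImplicit false
-- sibling precedent (`…TwoLayerDoorEvenIndex.lean`): the directory name repeats the summit name
set_option linter.dupNamespace false

noncomputable section

open scoped Classical IntermediateField NumberField Real nonZeroDivisors

namespace Summit.BirchSwinnertonDyer.BirchSwinnertonDyer.Theorems.AddKatoTwo

open WeierstrassCurve Field Polynomial IsDedekindDomain NumberField Matrix Literature.NumberTheory.EllipticCurves
  Literature.NumberTheory.GaloisRepresentations
  Literature.NumberTheory.IwasawaTheory
  Summit.BirchSwinnertonDyer.BirchSwinnertonDyer.Theorems.AlignedTransportAtTwoTorsionPointField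
  Summit.BirchSwinnertonDyer.BirchSwinnertonDyer.Theses.ByReductionTypeAtTwo

/-! ## §1 Irreducibility of the models -/

/-- `X³ + (0)X² + (33)X + (-76)` (a model of the cubic field of discriminant `-11988`) is irreducible over `ℚ` (no root mod `23`). -/
theorem irreducible_cubic_d11988n : Irreducible (Cubic.toPoly ⟨1, ((0 : ℤ) : ℚ), ((33 : ℤ) : ℚ), ((-76 : ℤ) : ℚ)⟩) :=
  haveI : Fact (Nat.Prime 23) := ⟨by norm_num⟩
  irreducible_cubic_of_no_root_zmod 23 (by decide)

/-- `X³ + (-1)X² + (-36)X + (-70)` (a model of the cubic field of discriminant `9980`) is irreducible over `ℚ` (no root mod `11`). -/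
theorem irreducible_cubic_d9980p : Irreducible (Cubic.toPoly ⟨1, ((-1 : ℤ) : ℚ), ((-36 : ℤ) : ℚ), ((-70 : ℤ) : ℚ)⟩) :=
  haveI : Fact (Nat.Prime 11) := ⟨by norm_num⟩
  irreducible_cubic_of_no_root_zmod 11 (by decide)

/-- `X³ + (0)X² + (-51)X + (-148)` (a model of the cubic field of discriminant `-6756`) is irreducible over `ℚ` (no root mod `5`). -/
theorem irreducible_cubic_d6756n : Irreducible (Cubic.toPoly ⟨1, ((0 : ℤ) : ℚ), ((-51 : ℤ) : ℚ), ((-148 : ℤ) : ℚ)⟩) :=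
  haveI : Fact (Nat.Prime 5) := ⟨by norm_num⟩
  irreducible_cubic_of_no_root_zmod 5 (by decide)

/-! ## §2 The stamps -/

/-- The census curve `227772e1` is an elliptic curve. -/
theorem isElliptic_227772e1' : (⟨0, ((0 : ℤ) : ℚ), 0, ((-1754845767 : ℤ) : ℚ), ((-28294794379890 : ℤ) : ℚ)⟩ : WeierstrassCurve ℚ).IsElliptic :=
  isElliptic_cubicModel _ _ _ (by simp only [Cubic.discr]; norm_num)

/-- **(A)₂ for `227772e1` from TWO parity bits** (a `C1″-RES` row of GEN 4's census: `2 = 𝔭²𝔮` in `ℚ(P)`, `d = -11988`). Granted `hLim2`;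
displayed: «`e_1 = 0` along the cyclotomic `ℤ₂`-extensions of `ℚ(θ)`» = `2 ∤ h(ℚ(θ, √2))` (census `cyc6 = []`); `2 ∤ #Cl(𝓞 ℚ(θ))` displayed (census `cyc3 = []`).
`θ` is any root of `X³ + (0)X² + (33)X + (-76)`; KERNEL: `ℚ(P) = ℚ(β) = ℚ(θ)` (`β = 175274/5 + (16286/5)θ + (7967/5)θ²` is a root of the
`2`-division cubic), Fukuda's index `0` by the EVEN-INDEX CERTIFICATE `u = [0, -2, 0]`, `v = [0, -1, -1]`, `m = [-76, -5, 17]`, `m' = [-3572, 14167, -6048]`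
(coordinates in `1, θ, θ²`; `N(2 − m'³) = -385398025154370760808264051881361265030`, `8 ∤`), Fukuda Thm. 1 (1).
[cite: Lim2017FineSelmer, §3 Thm. 3.5 and Lemma 3.2] [cite: Fukuda1994, Thm. 1 (1), p. 264] -/
theorem conjA_two_227772e1_of_twoBits
    (hLim2 : Lim2017.thm35_at_two_fineSelmerDual_moduleFinite_of_classicalMuVanishes_of_le_divisionField_four)
    {θ : AlgebraicClosure ℚ} (hθ : aeval θ (Cubic.toPoly ⟨1, ((0 : ℤ) : ℚ), ((33 : ℤ) : ℚ), ((-76 : ℤ) : ℚ)⟩) = 0)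
    (hh : ¬ 2 ∣ Nat.card (ClassGroup (𝓞 (IntermediateField.adjoin ℚ {θ}))))
    (h1 : haveI : FiniteDimensional ℚ (IntermediateField.adjoin ℚ {θ}) :=
        IntermediateField.adjoin.finiteDimensional ((AlgebraicClosure.isAlgebraic ℚ).isAlgebraic θ).isIntegral
      haveI : NumberField (IntermediateField.adjoin ℚ {θ}) := NumberField.mk
      ∀ κL : ZpExtension (IntermediateField.adjoin ℚ {θ}) 2, κL.IsCyclotomic → classNumberPExp κL 1 = 0)
    (κ : ZpExtension ℚ 2) (hκ : κ.IsCyclotomic) :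
    haveI := isElliptic_227772e1'
    ∃ (γ : absoluteGaloisGroup ℚ) (D : (⟨0, ((0 : ℤ) : ℚ), 0, ((-1754845767 : ℤ) : ℚ), ((-28294794379890 : ℤ) : ℚ)⟩ : WeierstrassCurve ℚ).FineSelmerDualData κ γ),
      Module.Finite ℤ_[2] (RestrictScalars ℤ_[2] (IwasawaAlgebra 2) D.X) := by
  haveI := isElliptic_227772e1'
  have hθ' : θ ^ 3 + (0 : AlgebraicClosure ℚ) * θ ^ 2 + (33 : AlgebraicClosure ℚ) * θ + (-76 : AlgebraicClosure ℚ) = 0 := by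
    have := hθ
    simp only [Cubic.toPoly, map_one, one_mul, aeval_add, aeval_mul, aeval_C, aeval_X_pow, aeval_X,
      eq_ratCast, Rat.cast_intCast] at this
    push_cast at this
    linear_combination this
  set β : AlgebraicClosure ℚ := algebraMap ℚ (AlgebraicClosure ℚ) (175274/5 : ℚ) +
      algebraMap ℚ (AlgebraicClosure ℚ) (16286/5 : ℚ) * θ + algebraMap ℚ (AlgebraicClosure ℚ) (7967/5 : ℚ) * θ ^ 2 with hβdef
  have hβ : aeval β (Cubic.toPoly ⟨1, ((0 : ℤ) : ℚ), ((-1754845767 : ℤ) : ℚ), ((-28294794379890 : ℤ) : ℚ)⟩) = 0 := by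
    simp only [Cubic.toPoly, map_one, one_mul, aeval_add, aeval_mul, aeval_C, aeval_X_pow, aeval_X, eq_ratCast,
      Rat.cast_intCast]
    rw [hβdef]
    simp only [eq_ratCast]
    push_cast
    linear_combination (((76864895212426 : AlgebraicClosure ℚ) / 125) + ((921085050411 : AlgebraicClosure ℚ) / 5) * θ + ((3101168182362 : AlgebraicClosure ℚ) / 125) * θ ^ 2 + ((505690100063 : AlgebraicClosure ℚ) / 125) * θ ^ 3) * hθ'
  have hadj : IntermediateField.adjoin ℚ {β} = IntermediateField.adjoin ℚ {θ} := by
    apply le_antisymm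
    · rw [IntermediateField.adjoin_simple_le_iff, hβdef]
      have hθmem := IntermediateField.mem_adjoin_simple_self ℚ θ
      exact add_mem (add_mem (algebraMap_mem _ _) (mul_mem (algebraMap_mem _ _) hθmem))
        (mul_mem (algebraMap_mem _ _) (pow_mem hθmem 2))
    · rw [IntermediateField.adjoin_simple_le_iff]
      have hθeq : θ = algebraMap ℚ (AlgebraicClosure ℚ) (1553428469521/19 : ℚ) +
          algebraMap ℚ (AlgebraicClosure ℚ) (64229185/38 : ℚ) * β +
          algebraMap ℚ (AlgebraicClosure ℚ) (-7967/114 : ℚ) * β ^ 2 := by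
        rw [hβdef]; simp only [eq_ratCast]; push_cast
        linear_combination (((1033722727454 : AlgebraicClosure ℚ) / 1425) + ((505690100063 : AlgebraicClosure ℚ) / 2850) * θ) * hθ'
      rw [hθeq]
      have hβmem := IntermediateField.mem_adjoin_simple_self ℚ β
      exact add_mem (add_mem (algebraMap_mem _ _) (mul_mem (algebraMap_mem _ _) hβmem))
        (mul_mem (algebraMap_mem _ _) (pow_mem hβmem 2))
  obtain ⟨P₀, hP₀, hP₀eq⟩ := exists_geomTorsion_two_eq_some_root ((0 : ℤ) : ℚ) ((-1754845767 : ℤ) : ℚ)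
    ((-28294794379890 : ℤ) : ℚ) hβ
  have hF : IntermediateField.fixedField (MulAction.stabilizer (absoluteGaloisGroup ℚ) P₀) =
      IntermediateField.adjoin ℚ {θ} := by
    rw [fixedField_stabilizer_eq_adjoin_root _ _ _ hβ hP₀eq, ← hadj]
    -- the two `Algebra ℚ ℚ̄` instance paths agree
    congr 1
  -- the even-index certificate in `𝓞 ℚ(θ)`
  have hirr := irreducible_cubic_d11988n
  haveI : FiniteDimensional ℚ (IntermediateField.adjoin ℚ {θ}) :=
    IntermediateField.adjoin.finiteDimensional ((AlgebraicClosure.isAlgebraic ℚ).isAlgebraic θ).isIntegral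
  haveI : NumberField (IntermediateField.adjoin ℚ {θ}) := NumberField.mk
  obtain ⟨B, -, hB⟩ := exists_ringOfIntegers_cubic_root (p := 0) (q := 33) (r := -76) hθ
  have h3 := finrank_adjoin_eq_three_of_irreducible hirr hθ
  refine fineSelmerDual_moduleFinite_two_of_evenIndexCertificate_pointField hLim2 _ hP₀ (p := 0) (q := 33) (r := -76) hirr hθ hF
    (((0 : ℤ) : 𝓞 (IntermediateField.adjoin ℚ {θ})) + ((-2 : ℤ) : 𝓞 (IntermediateField.adjoin ℚ {θ})) * B + ((0 : ℤ) : 𝓞 (IntermediateField.adjoin ℚ {θ})) * B ^ 2) (((0 : ℤ) : 𝓞 (IntermediateField.adjoin ℚ {θ})) + ((-1 : ℤ) : 𝓞 (IntermediateField.adjoin ℚ {θ})) * B + ((-1 : ℤ) : 𝓞 (IntermediateField.adjoin ℚ {θ})) * B ^ 2) (((-76 : ℤ) : 𝓞 (IntermediateField.adjoin ℚ {θ})) + ((-5 : ℤ) : 𝓞 (IntermediateField.adjoin ℚ {θ})) * B + ((17 : ℤ) : 𝓞 (IntermediateField.adjoin ℚ {θ})) * B ^ 2) (((-3572 : ℤ)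 : 𝓞 (IntermediateField.adjoin ℚ {θ})) + ((14167 : ℤ) : 𝓞 (IntermediateField.adjoin ℚ {θ})) * B + ((-6048 : ℤ) : 𝓞 (IntermediateField.adjoin ℚ {θ})) * B ^ 2) ?_ ?_ ?_
    hh h1 κ hκ
  · push_cast; linear_combination (((-4 : ℤ) : 𝓞 (IntermediateField.adjoin ℚ {θ})) + ((-2 : ℤ) : 𝓞 (IntermediateField.adjoin ℚ {θ})) * B) * hB
  · push_cast; linear_combination (((-170 : ℤ) : 𝓞 (IntermediateField.adjoin ℚ {θ})) + ((289 : ℤ) : 𝓞 (IntermediateField.adjoin ℚ {θ})) * B) * hB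
  · have hz : (2 : 𝓞 (IntermediateField.adjoin ℚ {θ})) - (((-3572 : ℤ) : 𝓞 (IntermediateField.adjoin ℚ {θ})) + ((14167 : ℤ) : 𝓞 (IntermediateField.adjoin ℚ {θ})) * B + ((-6048 : ℤ) : 𝓞 (IntermediateField.adjoin ℚ {θ})) * B ^ 2) ^ 3 =
        ((4821159821462574 : ℤ) : 𝓞 (IntermediateField.adjoin ℚ {θ})) + (-2342205213711657 : ℤ) * B + (-7960764352836 : ℤ) * B ^ 2 := by
      push_cast; linear_combination (((63435713758649 : ℤ) : 𝓞 (IntermediateField.adjoin ℚ {θ})) + ((-3266899757856 : ℤ) : 𝓞 (IntermediateField.adjoin ℚ {θ})) * B + ((-1554614498304 : ℤ) : 𝓞 (IntermediateField.adjoin ℚ {θ})) * B ^ 2 + ((221225582592 : ℤ) : 𝓞 (IntermediateField.adjoin ℚ {θ})) * B ^ 3) * hB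
    rw [hz]
    exact not_eight_dvd_norm_coords _ h3 B hirr hB (4821159821462574) (-2342205213711657) (-7960764352836) (N := -385398025154370760808264051881361265030)
      (by simp only [Matrix.one_fin_three, Matrix.det_fin_three, Matrix.add_apply, Matrix.smul_apply, sq, Matrix.mul_apply,
        Fin.sum_univ_three, Matrix.of_apply, Matrix.cons_val', Matrix.cons_val_zero, Matrix.cons_val_one, Matrix.cons_val_two,
        Matrix.head_cons, Matrix.tail_cons, Matrix.empty_val', Matrix.cons_val_fin_one, smul_eq_mul]; norm_num) (by norm_num)

/-- The census curve `279440c1` is an elliptic curve. -/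
theorem isElliptic_279440c1' : (⟨0, ((1 : ℤ) : ℚ), 0, ((-114041197436 : ℤ) : ℚ), ((-14823196533966296 : ℤ) : ℚ)⟩ : WeierstrassCurve ℚ).IsElliptic :=
  isElliptic_cubicModel _ _ _ (by simp only [Cubic.discr]; norm_num)

/-- **(A)₂ for `279440c1` from TWO parity bits** (a `C1″-RES` row of GEN 4's census: `2 = 𝔭²𝔮` in `ℚ(P)`, `d = 9980`). Granted `hLim2`;
displayed: «`e_1 = 0` along the cyclotomic `ℤ₂`-extensions of `ℚ(θ)`» = `2 ∤ h(ℚ(θ, √2))` (census `cyc6 = []`); `2 ∤ #Cl(𝓞 ℚ(θ))` displayed (census `cyc3 = []`).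
`θ` is any root of `X³ + (-1)X² + (-36)X + (-70)`; KERNEL: `ℚ(P) = ℚ(β) = ℚ(θ)` (`β = 1470966 + (233916)θ + (-63655)θ²` is a root of the
`2`-division cubic), Fukuda's index `0` by the EVEN-INDEX CERTIFICATE `u = [-2, -2, 0]`, `v = [0, -1, -1]`, `m = [-104, -87, -19]`, `m' = [133753, 87689, 14092]`
(coordinates in `1, θ, θ²`; `N(2 − m'³) = -19809702919113632574099882226550`, `8 ∤`), Fukuda Thm. 1 (1).
[cite: Lim2017FineSelmer, §3 Thm. 3.5 and Lemma 3.2] [cite: Fukuda1994, Thm. 1 (1), p. 264] -/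
theorem conjA_two_279440c1_of_twoBits
    (hLim2 : Lim2017.thm35_at_two_fineSelmerDual_moduleFinite_of_classicalMuVanishes_of_le_divisionField_four)
    {θ : AlgebraicClosure ℚ} (hθ : aeval θ (Cubic.toPoly ⟨1, ((-1 : ℤ) : ℚ), ((-36 : ℤ) : ℚ), ((-70 : ℤ) : ℚ)⟩) = 0)
    (hh : ¬ 2 ∣ Nat.card (ClassGroup (𝓞 (IntermediateField.adjoin ℚ {θ}))))
    (h1 : haveI : FiniteDimensional ℚ (IntermediateField.adjoin ℚ {θ}) :=
        IntermediateField.adjoin.finiteDimensional ((AlgebraicClosure.isAlgebraic ℚ).isAlgebraic θ).isIntegral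
      haveI : NumberField (IntermediateField.adjoin ℚ {θ}) := NumberField.mk
      ∀ κL : ZpExtension (IntermediateField.adjoin ℚ {θ}) 2, κL.IsCyclotomic → classNumberPExp κL 1 = 0)
    (κ : ZpExtension ℚ 2) (hκ : κ.IsCyclotomic) :
    haveI := isElliptic_279440c1'
    ∃ (γ : absoluteGaloisGroup ℚ) (D : (⟨0, ((1 : ℤ) : ℚ), 0, ((-114041197436 : ℤ) : ℚ), ((-14823196533966296 : ℤ) : ℚ)⟩ : WeierstrassCurve ℚ).FineSelmerDualData κ γ),
      Module.Finite ℤ_[2] (RestrictScalars ℤ_[2] (IwasawaAlgebra 2) D.X) := by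
  haveI := isElliptic_279440c1'
  have hθ' : θ ^ 3 + (-1 : AlgebraicClosure ℚ) * θ ^ 2 + (-36 : AlgebraicClosure ℚ) * θ + (-70 : AlgebraicClosure ℚ) = 0 := by
    have := hθ
    simp only [Cubic.toPoly, map_one, one_mul, aeval_add, aeval_mul, aeval_C, aeval_X_pow, aeval_X,
      eq_ratCast, Rat.cast_intCast] at this
    push_cast at this
    linear_combination this
  set β : AlgebraicClosure ℚ := algebraMap ℚ (AlgebraicClosure ℚ) (1470966 : ℚ) +
      algebraMap ℚ (AlgebraicClosure ℚ) (233916 : ℚ) * θ + algebraMap ℚ (AlgebraicClosure ℚ) (-63655 : ℚ) * θ ^ 2 with hβdef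
  have hβ : aeval β (Cubic.toPoly ⟨1, ((1 : ℤ) : ℚ), ((-114041197436 : ℤ) : ℚ), ((-14823196533966296 : ℤ) : ℚ)⟩) = 0 := by
    simp only [Cubic.toPoly, map_one, one_mul, aeval_add, aeval_mul, aeval_C, aeval_X_pow, aeval_X, eq_ratCast,
      Rat.cast_intCast]
    rw [hβdef]
    simp only [eq_ratCast]
    push_cast
    linear_combination ((-42860252107125034 : AlgebraicClosure ℚ) + (732050685724260 : AlgebraicClosure ℚ) * θ + (2585526690139325 : AlgebraicClosure ℚ) * θ ^ 2 + (-257927451736375 : AlgebraicClosure ℚ) * θ ^ 3) * hθ'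
  have hadj : IntermediateField.adjoin ℚ {β} = IntermediateField.adjoin ℚ {θ} := by
    apply le_antisymm
    · rw [IntermediateField.adjoin_simple_le_iff, hβdef]
      have hθmem := IntermediateField.mem_adjoin_simple_self ℚ θ
      exact add_mem (add_mem (algebraMap_mem _ _) (mul_mem (algebraMap_mem _ _) hθmem))
        (mul_mem (algebraMap_mem _ _) (pow_mem hθmem 2))
    · rw [IntermediateField.adjoin_simple_le_iff]
      have hθeq : θ = algebraMap ℚ (AlgebraicClosure ℚ) (49383642969422/1977326743 : ℚ) +
          algebraMap ℚ (AlgebraicClosure ℚ) (12409348439/193778020814 : ℚ) * β +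
          algebraMap ℚ (AlgebraicClosure ℚ) (-63655/193778020814 : ℚ) * β ^ 2 := by
        rw [hβdef]; simp only [eq_ratCast]; push_cast
        linear_combination (((-1637708642847425 : AlgebraicClosure ℚ) / 193778020814) + ((257927451736375 : AlgebraicClosure ℚ) / 193778020814) * θ) * hθ'
      rw [hθeq]
      have hβmem := IntermediateField.mem_adjoin_simple_self ℚ β
      exact add_mem (add_mem (algebraMap_mem _ _) (mul_mem (algebraMap_mem _ _) hβmem))
        (mul_mem (algebraMap_mem _ _) (pow_mem hβmem 2))
  obtain ⟨P₀, hP₀, hP₀eq⟩ := exists_geomTorsion_two_eq_some_root ((1 : ℤ) : ℚ) ((-114041197436 : ℤ) : ℚ)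
    ((-14823196533966296 : ℤ) : ℚ) hβ
  have hF : IntermediateField.fixedField (MulAction.stabilizer (absoluteGaloisGroup ℚ) P₀) =
      IntermediateField.adjoin ℚ {θ} := by
    rw [fixedField_stabilizer_eq_adjoin_root _ _ _ hβ hP₀eq, ← hadj]
    -- the two `Algebra ℚ ℚ̄` instance paths agree
    congr 1
  -- the even-index certificate in `𝓞 ℚ(θ)`
  have hirr := irreducible_cubic_d9980p
  haveI : FiniteDimensional ℚ (IntermediateField.adjoin ℚ {θ}) :=
    IntermediateField.adjoin.finiteDimensional ((AlgebraicClosure.isAlgebraic ℚ).isAlgebraic θ).isIntegral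
  haveI : NumberField (IntermediateField.adjoin ℚ {θ}) := NumberField.mk
  obtain ⟨B, -, hB⟩ := exists_ringOfIntegers_cubic_root (p := -1) (q := -36) (r := -70) hθ
  have h3 := finrank_adjoin_eq_three_of_irreducible hirr hθ
  refine fineSelmerDual_moduleFinite_two_of_evenIndexCertificate_pointField hLim2 _ hP₀ (p := -1) (q := -36) (r := -70) hirr hθ hF
    (((-2 : ℤ) : 𝓞 (IntermediateField.adjoin ℚ {θ})) + ((-2 : ℤ) : 𝓞 (IntermediateField.adjoin ℚ {θ})) * B + ((0 : ℤ) : 𝓞 (IntermediateField.adjoin ℚ {θ})) * B ^ 2) (((0 : ℤ) : 𝓞 (IntermediateField.adjoin ℚ {θ})) + ((-1 : ℤ) : 𝓞 (IntermediateField.adjoin ℚ {θ})) * B + ((-1 : ℤ) : 𝓞 (IntermediateField.adjoin ℚ {θ})) * B ^ 2) (((-104 : ℤ) : 𝓞 (IntermediateField.adjoin ℚ {θ})) + ((-87 : ℤ) : 𝓞 (IntermediateField.adjoin ℚ {θ})) * B + ((-19 : ℤ) : 𝓞 (IntermediateField.adjoin ℚ {θ})) * B ^ 2) (((133753 : ℤ)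 : 𝓞 (IntermediateField.adjoin ℚ {θ})) + ((87689 : ℤ) : 𝓞 (IntermediateField.adjoin ℚ {θ})) * B + ((14092 : ℤ) : 𝓞 (IntermediateField.adjoin ℚ {θ})) * B ^ 2) ?_ ?_ ?_
    hh h1 κ hκ
  · push_cast; linear_combination (((-6 : ℤ) : 𝓞 (IntermediateField.adjoin ℚ {θ})) + ((-2 : ℤ) : 𝓞 (IntermediateField.adjoin ℚ {θ})) * B) * hB
  · push_cast; linear_combination (((3667 : ℤ) : 𝓞 (IntermediateField.adjoin ℚ {θ})) + ((361 : ℤ) : 𝓞 (IntermediateField.adjoin ℚ {θ})) * B) * hB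
  · have hz : (2 : 𝓞 (IntermediateField.adjoin ℚ {θ})) - (((133753 : ℤ) : 𝓞 (IntermediateField.adjoin ℚ {θ})) + ((87689 : ℤ) : 𝓞 (IntermediateField.adjoin ℚ {θ})) * B + ((14092 : ℤ) : 𝓞 (IntermediateField.adjoin ℚ {θ})) * B ^ 2) ^ 3 =
        ((-310659536446928325 : ℤ) : 𝓞 (IntermediateField.adjoin ℚ {θ})) + (-202481407898755063 : ℤ) * B + (-32277857251404884 : ℤ) * B ^ 2 := by
      push_cast; linear_combination (((-4403810190462565 : ℤ) : 𝓞 (IntermediateField.adjoin ℚ {θ})) + ((-560542970339716 : ℤ) : 𝓞 (IntermediateField.adjoin ℚ {θ})) * B + ((-55039471457776 : ℤ) : 𝓞 (IntermediateField.adjoin ℚ {θ})) * B ^ 2 + ((-2798452266688 : ℤ) : 𝓞 (IntermediateField.adjoin ℚ {θ})) * B ^ 3) * hB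
    rw [hz]
    exact not_eight_dvd_norm_coords _ h3 B hirr hB (-310659536446928325) (-202481407898755063) (-32277857251404884) (N := -19809702919113632574099882226550)
      (by simp only [Matrix.one_fin_three, Matrix.det_fin_three, Matrix.add_apply, Matrix.smul_apply, sq, Matrix.mul_apply,
        Fin.sum_univ_three, Matrix.of_apply, Matrix.cons_val', Matrix.cons_val_zero, Matrix.cons_val_one, Matrix.cons_val_two,
        Matrix.head_cons, Matrix.tail_cons, Matrix.empty_val', Matrix.cons_val_fin_one, smul_eq_mul]; norm_num) (by norm_num)

/-- The census curve `297264q1` is an elliptic curve. -/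
theorem isElliptic_297264q1' : (⟨0, ((-1 : ℤ) : ℚ), 0, ((-80195004 : ℤ) : ℚ), ((-286282093668 : ℤ) : ℚ)⟩ : WeierstrassCurve ℚ).IsElliptic :=
  isElliptic_cubicModel _ _ _ (by simp only [Cubic.discr]; norm_num)

/-- **(A)₂ for `297264q1` from TWO parity bits** (a `C1″-RES` row of GEN 4's census: `2 = 𝔭²𝔮` in `ℚ(P)`, `d = -6756`). Granted `hLim2`;
displayed: «`e_1 = 0` along the cyclotomic `ℤ₂`-extensions of `ℚ(θ)`» = `2 ∤ h(ℚ(θ, √2))` (census `cyc6 = []`); `2 ∤ #Cl(𝓞 ℚ(θ))` displayed (census `cyc3 = []`).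
`θ` is any root of `X³ + (0)X² + (-51)X + (-148)`; KERNEL: `ℚ(P) = ℚ(β) = ℚ(θ)` (`β = -2005/3 + (3506/3)θ + (59/3)θ²` is a root of the
`2`-division cubic), Fukuda's index `0` by the EVEN-INDEX CERTIFICATE `u = [0, -2, 0]`, `v = [0, -1, -1]`, `m = [-148, -125, -25]`, `m' = [473452, 224125, 27450]`
(coordinates in `1, θ, θ²`; `N(2 − m'³) = -67030064143170275233513836266567175906966`, `8 ∤`), Fukuda Thm. 1 (1).
[cite: Lim2017FineSelmer, §3 Thm. 3.5 and Lemma 3.2] [cite: Fukuda1994, Thm. 1 (1), p. 264] -/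
theorem conjA_two_297264q1_of_twoBits
    (hLim2 : Lim2017.thm35_at_two_fineSelmerDual_moduleFinite_of_classicalMuVanishes_of_le_divisionField_four)
    {θ : AlgebraicClosure ℚ} (hθ : aeval θ (Cubic.toPoly ⟨1, ((0 : ℤ) : ℚ), ((-51 : ℤ) : ℚ), ((-148 : ℤ) : ℚ)⟩) = 0)
    (hh : ¬ 2 ∣ Nat.card (ClassGroup (𝓞 (IntermediateField.adjoin ℚ {θ}))))
    (h1 : haveI : FiniteDimensional ℚ (IntermediateField.adjoin ℚ {θ}) :=
        IntermediateField.adjoin.finiteDimensional ((AlgebraicClosure.isAlgebraic ℚ).isAlgebraic θ).isIntegral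
      haveI : NumberField (IntermediateField.adjoin ℚ {θ}) := NumberField.mk
      ∀ κL : ZpExtension (IntermediateField.adjoin ℚ {θ}) 2, κL.IsCyclotomic → classNumberPExp κL 1 = 0)
    (κ : ZpExtension ℚ 2) (hκ : κ.IsCyclotomic) :
    haveI := isElliptic_297264q1'
    ∃ (γ : absoluteGaloisGroup ℚ) (D : (⟨0, ((-1 : ℤ) : ℚ), 0, ((-80195004 : ℤ) : ℚ), ((-286282093668 : ℤ) : ℚ)⟩ : WeierstrassCurve ℚ).FineSelmerDualData κ γ),
      Module.Finite ℤ_[2] (RestrictScalars ℤ_[2] (IwasawaAlgebra 2) D.X) := by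
  haveI := isElliptic_297264q1'
  have hθ' : θ ^ 3 + (0 : AlgebraicClosure ℚ) * θ ^ 2 + (-51 : AlgebraicClosure ℚ) * θ + (-148 : AlgebraicClosure ℚ) = 0 := by
    have := hθ
    simp only [Cubic.toPoly, map_one, one_mul, aeval_add, aeval_mul, aeval_C, aeval_X_pow, aeval_X,
      eq_ratCast, Rat.cast_intCast] at this
    push_cast at this
    linear_combination this
  set β : AlgebraicClosure ℚ := algebraMap ℚ (AlgebraicClosure ℚ) (-2005/3 : ℚ) +
      algebraMap ℚ (AlgebraicClosure ℚ) (3506/3 : ℚ) * θ + algebraMap ℚ (AlgebraicClosure ℚ) (59/3 : ℚ) * θ ^ 2 with hβdef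
  have hβ : aeval β (Cubic.toPoly ⟨1, ((-1 : ℤ) : ℚ), ((-80195004 : ℤ) : ℚ), ((-286282093668 : ℤ) : ℚ)⟩) = 0 := by
    simp only [Cubic.toPoly, map_one, one_mul, aeval_add, aeval_mul, aeval_C, aeval_X_pow, aeval_X, eq_ratCast,
      Rat.cast_intCast]
    rw [hβdef]
    simp only [eq_ratCast]
    push_cast
    linear_combination (((42503850622 : AlgebraicClosure ℚ) / 27) + ((721738681 : AlgebraicClosure ℚ) / 9) * θ + ((12204386 : AlgebraicClosure ℚ) / 9) * θ ^ 2 + ((205379 : AlgebraicClosure ℚ) / 27) * θ ^ 3) * hθ'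
  have hadj : IntermediateField.adjoin ℚ {β} = IntermediateField.adjoin ℚ {θ} := by
    apply le_antisymm
    · rw [IntermediateField.adjoin_simple_le_iff, hβdef]
      have hθmem := IntermediateField.mem_adjoin_simple_self ℚ θ
      exact add_mem (add_mem (algebraMap_mem _ _) (mul_mem (algebraMap_mem _ _) hθmem))
        (mul_mem (algebraMap_mem _ _) (pow_mem hθmem 2))
    · rw [IntermediateField.adjoin_simple_le_iff]
      have hθeq : θ = algebraMap ℚ (AlgebraicClosure ℚ) (1576488812/2357947691 : ℚ) +
          algebraMap ℚ (AlgebraicClosure ℚ) (4077659/4715895382 : ℚ) * β +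
          algebraMap ℚ (AlgebraicClosure ℚ) (-59/4715895382 : ℚ) * β ^ 2 := by
        rw [hβdef]; simp only [eq_ratCast]; push_cast
        linear_combination (((12204386 : AlgebraicClosure ℚ) / 21221529219) + ((205379 : AlgebraicClosure ℚ) / 42443058438) * θ) * hθ'
      rw [hθeq]
      have hβmem := IntermediateField.mem_adjoin_simple_self ℚ β
      exact add_mem (add_mem (algebraMap_mem _ _) (mul_mem (algebraMap_mem _ _) hβmem))
        (mul_mem (algebraMap_mem _ _) (pow_mem hβmem 2))
  obtain ⟨P₀, hP₀, hP₀eq⟩ := exists_geomTorsion_two_eq_some_root ((-1 : ℤ) : ℚ) ((-80195004 : ℤ) : ℚ)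
    ((-286282093668 : ℤ) : ℚ) hβ
  have hF : IntermediateField.fixedField (MulAction.stabilizer (absoluteGaloisGroup ℚ) P₀) =
      IntermediateField.adjoin ℚ {θ} := by
    rw [fixedField_stabilizer_eq_adjoin_root _ _ _ hβ hP₀eq, ← hadj]
    -- the two `Algebra ℚ ℚ̄` instance paths agree
    congr 1
  -- the even-index certificate in `𝓞 ℚ(θ)`
  have hirr := irreducible_cubic_d6756n
  haveI : FiniteDimensional ℚ (IntermediateField.adjoin ℚ {θ}) :=
    IntermediateField.adjoin.finiteDimensional ((AlgebraicClosure.isAlgebraic ℚ).isAlgebraic θ).isIntegral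
  haveI : NumberField (IntermediateField.adjoin ℚ {θ}) := NumberField.mk
  obtain ⟨B, -, hB⟩ := exists_ringOfIntegers_cubic_root (p := 0) (q := -51) (r := -148) hθ
  have h3 := finrank_adjoin_eq_three_of_irreducible hirr hθ
  refine fineSelmerDual_moduleFinite_two_of_evenIndexCertificate_pointField hLim2 _ hP₀ (p := 0) (q := -51) (r := -148) hirr hθ hF
    (((0 : ℤ) : 𝓞 (IntermediateField.adjoin ℚ {θ})) + ((-2 : ℤ) : 𝓞 (IntermediateField.adjoin ℚ {θ})) * B + ((0 : ℤ) : 𝓞 (IntermediateField.adjoin ℚ {θ})) * B ^ 2) (((0 : ℤ) : 𝓞 (IntermediateField.adjoin ℚ {θ})) + ((-1 : ℤ) : 𝓞 (IntermediateField.adjoin ℚ {θ})) * B + ((-1 : ℤ) : 𝓞 (IntermediateField.adjoin ℚ {θ})) * B ^ 2) (((-148 : ℤ) : 𝓞 (IntermediateField.adjoin ℚ {θ})) + ((-125 : ℤ) : 𝓞 (IntermediateField.adjoin ℚ {θ})) * B + ((-25 : ℤ) : 𝓞 (IntermediateField.adjoin ℚ {θ})) * B ^ 2) (((473452 : ℤ)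 : 𝓞 (IntermediateField.adjoin ℚ {θ})) + ((224125 : ℤ) : 𝓞 (IntermediateField.adjoin ℚ {θ})) * B + ((27450 : ℤ) : 𝓞 (IntermediateField.adjoin ℚ {θ})) * B ^ 2) ?_ ?_ ?_
    hh h1 κ hκ
  · push_cast; linear_combination (((-4 : ℤ) : 𝓞 (IntermediateField.adjoin ℚ {θ})) + ((-2 : ℤ) : 𝓞 (IntermediateField.adjoin ℚ {θ})) * B) * hB
  · push_cast; linear_combination (((6250 : ℤ) : 𝓞 (IntermediateField.adjoin ℚ {θ})) + ((625 : ℤ) : 𝓞 (IntermediateField.adjoin ℚ {θ})) * B) * hB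
  · have hz : (2 : 𝓞 (IntermediateField.adjoin ℚ {θ})) - (((473452 : ℤ) : 𝓞 (IntermediateField.adjoin ℚ {θ})) + ((224125 : ℤ) : 𝓞 (IntermediateField.adjoin ℚ {θ})) * B + ((27450 : ℤ) : 𝓞 (IntermediateField.adjoin ℚ {θ})) * B ^ 2) ^ 3 =
        ((-8636047589761233906 : ℤ) : 𝓞 (IntermediateField.adjoin ℚ {θ})) + (-4016815474903693875 : ℤ) * B + (-484136240522118150 : ℤ) * B ^ 2 := by
      push_cast; linear_combination (((-57634595312415625 : ℤ) : 𝓞 (IntermediateField.adjoin ℚ {θ})) + ((-6261714108483750 : ℤ) : 𝓞 (IntermediateField.adjoin ℚ {θ})) * B + ((-506636243437500 : ℤ) : 𝓞 (IntermediateField.adjoin ℚ {θ})) * B ^ 2 + ((-20683643625000 : ℤ) : 𝓞 (IntermediateField.adjoin ℚ {θ})) * B ^ 3) * hB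
    rw [hz]
    exact not_eight_dvd_norm_coords _ h3 B hirr hB (-8636047589761233906) (-4016815474903693875) (-484136240522118150) (N := -67030064143170275233513836266567175906966)
      (by simp only [Matrix.one_fin_three, Matrix.det_fin_three, Matrix.add_apply, Matrix.smul_apply, sq, Matrix.mul_apply,
        Fin.sum_univ_three, Matrix.of_apply, Matrix.cons_val', Matrix.cons_val_zero, Matrix.cons_val_one, Matrix.cons_val_two,
        Matrix.head_cons, Matrix.tail_cons, Matrix.empty_val', Matrix.cons_val_fin_one, smul_eq_mul]; norm_num) (by norm_num)

end Summit.BirchSwinnertonDyer.BirchSwinnertonDyer.Theorems.AddKatoTwo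

end
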